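import Summits.BirchSwinnertonDyer.BirchSwinnertonDyer.Theorems.PrintCf2SplitBadTwoRestrictedSelmerCokernelKernelIdentity
import Summits.BirchSwinnertonDyer.BirchSwinnertonDyer.Theorems.PrintCf2SplitBadTwoRestrictedSelmerInflationKernelCard
import Summits.BirchSwinnertonDyer.BirchSwinnertonDyer.Theorems.PrintCf2SplitBadTwoControlCokernelOfFrame
import Summits.BirchSwinnertonDyer.BirchSwinnertonDyer.Theorems.PrintCf2SplitBadTwoRestrictedSelmerControlKernelExact
import Summits.BirchSwinnertonDyer.BirchSwinnertonDyer.Theorems.PrintCf2SplitBadTwoTowerTorsionSharp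
import HarnessLib

/-!
# Crux `PrintCf2.SplitBadTwoRankOneOfFacts` (stmt-BirchSwinnertonDyer-20368), road α v10.3 — S3c residual (R-SURJ), file 3/3:
# ON EVERY S3c FRAME `#ker(res) = 2`, so `[𝔖^Γ : res 𝔖_{v̄}(K, W*)] · 2 ∣ (∏_{w∈T} #LK_w) · #LK_{v̄}` under (H7) —
# the displayed hypothesis (R-SURJ) of cut 4 («`[𝔖^Γ : res 𝔖] = (∏_{w∈T} #LK_w) · #LK_{v̄}`») FAILS on every such frame

Cell `bsd-print-cf2`, width seat `bsd-line-cf2-p1-w5` g3 (prover-bsd-line-cf2-p1-w5-g3-0); lane «(R-SURJ)» of LEAD g12's residual board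
(`LEAD-VERDICT-cf2p1-g12.md` §6; cut 4 = `restrictedControl_two_of_residuals_split_places`, p666063). `--supports stmt-BirchSwinnertonDyer-20368`
(helper, Theses-free). HONEST FRAMING: nothing here closes the crux or a registered stub; BSD is not proved by any of this; no summit statement
is proved by this seat. No definition, no named fact, no `sorry`.

WHAT (road α, `M = W* = ↥((W.baseChange K).endEigenPrimaryTorsion 2 π r)`; every S3c frame: member `C • W = cm7^{(d)}`, `d ≠ 0` squarefree, `K` imaginary
quadratic, `v ≠ v̄` over `2`, `π² = π − 2` in `End_K(E_K)`, `r² = r − 2`, `κ'` unramified outside `v̄` with generator `γ'`, `T = {w : 2 ∉ w, 7d ∈ w}`;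
`#ker(control) := #(𝔖_{v̄}(K, W*) ⊓ ker res)`):
* **`natCard_ker_resOfLe_top_of_frame_eq_two`: `#ker (res : H¹(K, W*) → H¹(K*_∞, W*)) = 2`** (file 2/3 + p656507 `#(W*(K*_∞) ⧸ (γ' − 1)) = 2`) —
  the LEAD's «`ker res = H¹(Γ, W*(K*_∞)) = Hom(Γ, ℤ/2)` has order `2`» (p656507 docstring) as a kernel theorem (p654573 had `≤`);
* `two_mul_relIndex_control_of_frame_eq`: **`[𝔖^Γ : res 𝔖] · 2 = [A : 𝔖_{v̄}(K, W*)] · #ker(control)`** (file 1/3), `A = res⁻¹(𝔖^Γ)` the lifts;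
* `two_mul_relIndex_control_of_frame_dvd`: `[𝔖^Γ : res 𝔖] · 2 ∣ (∏_{w∈T} #LK_w) · #LK_{v̄} · #ker(control)` (no (H7); -w3 g7's local values);
* under (H7) «the place above `7` does not split completely in the first layer of `κ'`» (-w6 g2 `ker_control_of_frame_eq_bot`: `#ker(control) = 1`):
  **`two_mul_relIndex_control_of_frame_dvd_of_not_decomp_le`: `[𝔖^Γ : res 𝔖] · 2 ∣ (∏_{w∈T} #LK_w) · #LK_{v̄}`**,
  **`relIndex_control_of_frame_lt_prod_of_not_decomp_le`: `[𝔖^Γ : res 𝔖] < (∏_{w∈T} #LK_w) · #LK_{v̄}`**,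
  **`false_of_rSurj_of_frame_of_not_decomp_le`: the displayed `hSurj` of cut 4 (p666063) VERBATIM + one frame with (H7) ⟹ `False`**;
* without (H7): `natCard_ker_control_of_frame_eq_two_of_relIndex_eq_prod` — (R-SURJ)'s equality at a frame forces `#ker(control) = 2` there:
  (R-SURJ) and (R-KER) «`#ker(control) = 1`» are inconsistent frame by frame.
CONSEQUENCE FOR THE S3c ASSEMBLY. (R-SURJ) as typed in cuts 2–4 (p664744, p665014, p666063) is undischargeable: it holds on no frame satisfying (H7),
and (H7) holds for the CFT line `K*_∞` of `ℚ(√−7)` (memo `B15-DYADIC-EXACT-w2g9.md` §1 (C2); -w6 g2's first-layer files). The honest form of the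
LEAD's «δ = 1» (local-class map of the lifts ONTO `⊕ LK_w`, memo `S3C-DEFECT-VANISHES-g12.md`) is
**(R-SURJ′) `[𝔖^Γ : res 𝔖_{v̄}(K, W*)] · 2 = (∏_{w∈T} #LK_w) · #LK_{v̄}`** (⟺ `[A : 𝔖_{v̄}(K, W*)] = ∏`, by `two_mul_relIndex_control_of_frame_eq`
and `#ker(control) = 1`), under which the class function `e_C` of S3c shifts by the constant `−1`; S3c's `∃ eC` is unaffected, the cut's
displayed hypothesis and its bookkeeping line change. Whether (R-SURJ′) holds (the rank-one Poitou–Tate argument of the memo) is NOT addressed here.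
presearch: Greenberg LNM 1716 §3 Lemmas 3.1–3.3 (held, pp. 86–88); Agboola 2007 §3 Prop. 3.2, §6 (arXiv:math/0602192 p0008, p0013 — bounds only,
no exact cokernel in print at any `p`); Serre *Galois Cohomology* I §2.6 — held; no new Literature fact filed. beyond-print theorem: no.

References: [GreenbergLNM1716] §3 Lemmas 3.1–3.3 (pp. 86–88); [Agboola2007] §3 Prop. 3.2 (arXiv p0008:L128–135, L197), §6.
-/

noncomputable section

open scoped Classical

set_option linter.dupNamespace false
set_option autoImplicit false

open NumberField IsDedekindDomain Field
open Literature.NumberTheory.EllipticCurves Literature.NumberTheory.EllipticCurves.GreenbergSelmer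
open Literature.NumberTheory.EllipticCurves.Agboola2007
open Literature.NumberTheory.EllipticCurves.IwasawaDual
open Literature.NumberTheory.EllipticCurves.ResKernel
open Literature.NumberTheory.GaloisRepresentations

universe u

namespace Summit.BirchSwinnertonDyer.BirchSwinnertonDyer.Theorems.PrintCf2.RestrictedSelmerPair

/-! ## §4. Road α: on every S3c frame `#ker(res) = 2`, so `2 · [𝔖^Γ : res 𝔖_{v̄}(K, W*)] ∣ (∏_{w∈T} #LK_w) · #LK_{v̄}` under (H7) —
the displayed hypothesis (R-SURJ) of cut 4 («`[𝔖^Γ : res 𝔖] = (∏_{w∈T} #LK_w) · #LK_{v̄}`») fails on every such frame -/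

section Frame

open WeierstrassCurve
open Summit.BirchSwinnertonDyer.BirchSwinnertonDyer.Theorems.PrintCf2.AdditiveAtSeven
open Summit.BirchSwinnertonDyer.BirchSwinnertonDyer.Theorems.GoldfeldGoodTwists

variable {K : Type} [Field K] [NumberField K]

/-- **`#ker (res : H¹(K, W*) → H¹(K*_∞, W*)) = 2` EXACTLY on every S3c frame** (member `C • W = cm7^{(d)}`, `K` imaginary quadratic,
`v̄ ∣ 2`, `π² = π − 2` in `End_K(E_K)`, `r² = r − 2`, `κ'` unramified outside `v̄` with topological generator `γ'`): §3 with p656507's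
`#(W*(K*_∞) ⧸ (γ' − 1)) = 2` (`W*(K*_∞) = W*[2]`, `Γ` acting trivially; `√−7 ∈ K` from the `K`-rational `π`). The LEAD's «`ker res =
H¹(Γ, W*(K*_∞)) = Hom(Γ, ℤ/2)` has order `2`» (p656507 docstring) as a kernel theorem — p654573 had `≤`.
[cite: GreenbergLNM1716, §3 Lemma 3.1 (p. 86)] [cite: Agboola2007, §3 Prop. 3.2 (arXiv p0008:L128–135)] -/
theorem natCard_ker_resOfLe_top_of_frame_eq_two {d : ℤ} (hd0 : d ≠ 0) (W : WeierstrassCurve ℚ) [W.IsElliptic]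
    (C : VariableChange ℚ) (hC : C • W = cm7.quadraticTwist (d : ℚ)) (hK : IsImaginaryQuadratic K)
    (vbar : HeightOneSpectrum (𝓞 K)) (hvbar : ((2 : ℕ) : 𝓞 K) ∈ vbar.asIdeal)
    (π : (W.baseChange K).endRing) (hrel : (π : AddMonoid.End (W.baseChange K).geomPoints) * π = π - 2)
    {r : ℤ_[2]} (hr : r * r = r - 2) (κ' : ZpExtension K 2) (hκ' : κ'.IsUnramifiedOutside vbar)
    {γ' : absoluteGaloisGroup K} (hγ' : κ'.IsTopGenerator γ') :
    Nat.card (resOfLe ↥((W.baseChange K).endEigenPrimaryTorsion 2 π r) (le_top : κ'.kerSubgroup ≤ ⊤)).ker = 2 := by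
  have hj : W.j = -3375 := j_eq_of_smul_eq_cm7Twist hd0 W C hC
  obtain ⟨θ, hθ⟩ := exists_sq_eq_neg_seven_of_cmEndo_mem_endRing W K hj π hrel
  haveI : (W.baseChange K).IsElliptic := by rw [baseChange]; infer_instance
  rw [natCard_ker_resOfLe_top_eq κ' ↥((W.baseChange K).endEigenPrimaryTorsion 2 π r) hγ'
    (continuous_smul_endEigenPrimaryTorsion (W.baseChange K) 2 π r)
    (exists_pow_smul_endEigenPrimaryTorsion_eq_zero (W.baseChange K) 2 π r)]
  exact natCard_fixedPoints_quotient_subOne_of_frame_eq_two hd0 W C hC hK hθ vbar hvbar π hrel hr κ' hκ' γ'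

/-- **THE EXACT COKERNEL ON EVERY S3c FRAME (no (H7)): `2 · [𝔖^Γ : res 𝔖_{v̄}(K, W*)] = [A : 𝔖_{v̄}(K, W*)] · #ker(control)`**, with
`A = res⁻¹(𝔖^Γ)` the lifts and `ker(control) = 𝔖_{v̄}(K, W*) ⊓ ker res` (order `1` or `2`, p656507). §2 with §4's `#ker res = 2`.
[cite: GreenbergLNM1716, §3 Lemmas 3.1–3.2] [cite: Agboola2007, §3 Prop. 3.2] -/
theorem two_mul_relIndex_control_of_frame_eq {d : ℤ} (hd0 : d ≠ 0) (W : WeierstrassCurve ℚ) [W.IsElliptic]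
    (C : VariableChange ℚ) (hC : C • W = cm7.quadraticTwist (d : ℚ)) (hK : IsImaginaryQuadratic K)
    (vbar : HeightOneSpectrum (𝓞 K)) (hvbar : ((2 : ℕ) : 𝓞 K) ∈ vbar.asIdeal)
    (π : (W.baseChange K).endRing) (hrel : (π : AddMonoid.End (W.baseChange K).geomPoints) * π = π - 2)
    {r : ℤ_[2]} (hr : r * r = r - 2) (κ' : ZpExtension K 2) (hκ' : κ'.IsUnramifiedOutside vbar)
    {γ' : absoluteGaloisGroup K} (hγ' : κ'.IsTopGenerator γ') :
    (((restrictedSelmerBase ↥((W.baseChange K).endEigenPrimaryTorsion 2 π r) 2 vbar).map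
        (resOfLe ↥((W.baseChange K).endEigenPrimaryTorsion 2 π r) (le_top : κ'.kerSubgroup ≤ ⊤))).addSubgroupOf
        (restrictedSelmerZp κ' ↥((W.baseChange K).endEigenPrimaryTorsion 2 π r) vbar)).relIndex
      (endInvariants (conjRestricted κ' ↥((W.baseChange K).endEigenPrimaryTorsion 2 π r) vbar γ' - 1)) * 2 =
    ((restrictedSelmerBase ↥((W.baseChange K).endEigenPrimaryTorsion 2 π r) 2 vbar).addSubgroupOf
        (((endInvariants (conjRestricted κ' ↥((W.baseChange K).endEigenPrimaryTorsion 2 π r) vbar γ' - 1)).map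
          (restrictedSelmerZp κ' ↥((W.baseChange K).endEigenPrimaryTorsion 2 π r) vbar).subtype).comap
          (resOfLe ↥((W.baseChange K).endEigenPrimaryTorsion 2 π r) (le_top : κ'.kerSubgroup ≤ ⊤)))).index *
      Nat.card ↥(restrictedSelmerBase ↥((W.baseChange K).endEigenPrimaryTorsion 2 π r) 2 vbar ⊓
        (resOfLe ↥((W.baseChange K).endEigenPrimaryTorsion 2 π r) (le_top : κ'.kerSubgroup ≤ ⊤)).ker) := by
  have h := relIndex_mul_natCard_ker_eq_index_mul_natCard_inf κ' ↥((W.baseChange K).endEigenPrimaryTorsion 2 π r) vbar hγ'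
    (continuous_smul_endEigenPrimaryTorsion (W.baseChange K) 2 π r)
    (exists_pow_smul_endEigenPrimaryTorsion_eq_zero (W.baseChange K) 2 π r)
  rw [natCard_ker_resOfLe_top_of_frame_eq_two hd0 W C hC hK vbar hvbar π hrel hr κ' hκ' hγ'] at h
  exact h

/-- **`2 · [𝔖^Γ : res 𝔖_{v̄}(K, W*)] ∣ (∏_{w∈T} #LK_w) · #LK_{v̄} · #ker(control)` ON EVERY S3c FRAME** (`T = {w : 2 ∉ w, 7d ∈ w}`; member,
`K` imaginary quadratic, `v ≠ v̄` over `2`, `π, r`, `κ'` unramified outside `v̄`, `γ'`): the frame bound of -w3 g7 / LEAD g11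
(`relIndex_control_of_frame_le`, p658316/p658763) WITH the inflation kernel `#ker res = 2` and the control kernel carried explicitly. No (H7).
[cite: Agboola2007, §3 Prop. 3.2, §6] [cite: GreenbergLNM1716, §3 Lemmas 3.1–3.3] -/
theorem two_mul_relIndex_control_of_frame_dvd {d : ℤ} (hd0 : d ≠ 0) (hsq : Squarefree d)
    (W : WeierstrassCurve ℚ) [W.IsElliptic] (C : VariableChange ℚ) (hC : C • W = cm7.quadraticTwist (d : ℚ))
    (hK : IsImaginaryQuadratic K) {v vbar : HeightOneSpectrum (𝓞 K)} (hv : ((2 : ℕ) : 𝓞 K) ∈ v.asIdeal)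
    (hvbar : ((2 : ℕ) : 𝓞 K) ∈ vbar.asIdeal) (hne : vbar ≠ v) (π : (W.baseChange K).endRing)
    (hrel : (π : AddMonoid.End (W.baseChange K).geomPoints) * π = π - 2) {r : ℤ_[2]} (hr : r * r = r - 2)
    (κ' : ZpExtension K 2) (hκ' : κ'.IsUnramifiedOutside vbar) {γ' : absoluteGaloisGroup K} (hγ' : κ'.IsTopGenerator γ')
    (T : Finset (HeightOneSpectrum (𝓞 K)))
    (hT : ∀ w : HeightOneSpectrum (𝓞 K), w ∈ T ↔ ((2 : ℕ) : 𝓞 K) ∉ w.asIdeal ∧ ((7 * d : ℤ) : 𝓞 K) ∈ w.asIdeal) :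
    (((restrictedSelmerBase ↥((W.baseChange K).endEigenPrimaryTorsion 2 π r) 2 vbar).map
        (resOfLe ↥((W.baseChange K).endEigenPrimaryTorsion 2 π r) (le_top : κ'.kerSubgroup ≤ ⊤))).addSubgroupOf
        (restrictedSelmerZp κ' ↥((W.baseChange K).endEigenPrimaryTorsion 2 π r) vbar)).relIndex
      (endInvariants (conjRestricted κ' ↥((W.baseChange K).endEigenPrimaryTorsion 2 π r) vbar γ' - 1)) * 2 ∣
      (∏ w ∈ T, Nat.card (resOfLe ↥((W.baseChange K).endEigenPrimaryTorsion 2 π r)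
          (inf_le_inf_right (decomp w) (le_top : κ'.kerSubgroup ≤ ⊤))).ker) *
        Nat.card (resOfLe ↥((W.baseChange K).endEigenPrimaryTorsion 2 π r)
          (inf_le_inf_right (decomp vbar) (le_top : κ'.kerSubgroup ≤ ⊤))).ker *
        Nat.card ↥(restrictedSelmerBase ↥((W.baseChange K).endEigenPrimaryTorsion 2 π r) 2 vbar ⊓
          (resOfLe ↥((W.baseChange K).endEigenPrimaryTorsion 2 π r) (le_top : κ'.kerSubgroup ≤ ⊤)).ker) := by
  set M := ↥((W.baseChange K).endEigenPrimaryTorsion 2 π r) with hM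
  have hTp : ∀ w ∈ T, ((2 : ℕ) : 𝓞 K) ∉ w.asIdeal := fun w hw ↦ ((hT w).mp hw).1
  have hT0 : ∀ w : HeightOneSpectrum (𝓞 K), ((2 : ℕ) : 𝓞 K) ∉ w.asIdeal → w ∉ T →
      (resOfLe M (inf_le_inf_right (decomp w) (le_top : κ'.kerSubgroup ≤ ⊤))).ker = ⊥ := by
    intro w h2w hwT
    have h7d : ((7 * d : ℤ) : 𝓞 K) ∉ w.asIdeal := fun h ↦ hwT ((hT w).mpr ⟨h2w, h⟩)
    exact localKer_top_of_frame_eq_bot hd0 W C hC vbar hvbar π hrel hr κ' hκ' h2w h7d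
  have hfinT : ∀ w ∈ T, Finite (resOfLe M (inf_le_inf_right (decomp w) (le_top : κ'.kerSubgroup ≤ ⊤))).ker :=
    fun w hw ↦ (finite_and_natCard_localKer_top_of_frame_le_two hd0 hsq W C hC hK vbar hvbar π hrel hr κ' hκ'
      ((hT w).mp hw).1 ((hT w).mp hw).2).1
  obtain ⟨hfinq, -⟩ := finite_and_natCard_localKer_top_vbar_of_frame_le_four hd0 W C hC hK hv hvbar hne π hrel hr κ'
  have h := relIndex_mul_natCard_ker_dvd_prod_natCard_localKer_mul κ' M vbar hγ'
    (continuous_smul_endEigenPrimaryTorsion (W.baseChange K) 2 π r)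
    (exists_pow_smul_endEigenPrimaryTorsion_eq_zero (W.baseChange K) 2 π r) T hTp hT0
    (localKer_decompInf_eq_bot_of_isImaginaryQuadratic κ' M hK) hfinT hfinq
  rw [natCard_ker_resOfLe_top_of_frame_eq_two hd0 W C hC hK vbar hvbar π hrel hr κ' hκ' hγ'] at h
  exact h

/-- **Under (H7) — the place above `7` does not split completely in the first layer of `κ'` — `2 · [𝔖^Γ : res 𝔖_{v̄}(K, W*)] ∣ (∏_{w∈T} #LK_w) · #LK_{v̄}`**
on every S3c frame: the control kernel is `⊥` there (-w6 g2 `ker_control_of_frame_eq_bot`), so the inflation kernel's factor `2` is NOT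
compensated. [cite: Agboola2007, §3 Prop. 3.2, §6] [cite: GreenbergLNM1716, §3 Lemmas 3.1–3.3] -/
theorem two_mul_relIndex_control_of_frame_dvd_of_not_decomp_le {d : ℤ} (hd0 : d ≠ 0) (hsq : Squarefree d)
    (W : WeierstrassCurve ℚ) [W.IsElliptic] (C : VariableChange ℚ) (hC : C • W = cm7.quadraticTwist (d : ℚ))
    (hK : IsImaginaryQuadratic K) {v vbar : HeightOneSpectrum (𝓞 K)} (hv : ((2 : ℕ) : 𝓞 K) ∈ v.asIdeal)
    (hvbar : ((2 : ℕ) : 𝓞 K) ∈ vbar.asIdeal) (hne : vbar ≠ v) (π : (W.baseChange K).endRing)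
    (hrel : (π : AddMonoid.End (W.baseChange K).geomPoints) * π = π - 2) {r : ℤ_[2]} (hr : r * r = r - 2)
    (κ' : ZpExtension K 2) (hκ' : κ'.IsUnramifiedOutside vbar) {γ' : absoluteGaloisGroup K} (hγ' : κ'.IsTopGenerator γ')
    (T : Finset (HeightOneSpectrum (𝓞 K)))
    (hT : ∀ w : HeightOneSpectrum (𝓞 K), w ∈ T ↔ ((2 : ℕ) : 𝓞 K) ∉ w.asIdeal ∧ ((7 * d : ℤ) : 𝓞 K) ∈ w.asIdeal)
    {w₇ : HeightOneSpectrum (𝓞 K)} (h7 : ((7 : ℕ) : 𝓞 K) ∈ w₇.asIdeal) (hsplit : ¬ decomp w₇ ≤ κ'.layerSubgroup 1) :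
    (((restrictedSelmerBase ↥((W.baseChange K).endEigenPrimaryTorsion 2 π r) 2 vbar).map
        (resOfLe ↥((W.baseChange K).endEigenPrimaryTorsion 2 π r) (le_top : κ'.kerSubgroup ≤ ⊤))).addSubgroupOf
        (restrictedSelmerZp κ' ↥((W.baseChange K).endEigenPrimaryTorsion 2 π r) vbar)).relIndex
      (endInvariants (conjRestricted κ' ↥((W.baseChange K).endEigenPrimaryTorsion 2 π r) vbar γ' - 1)) * 2 ∣
      (∏ w ∈ T, Nat.card (resOfLe ↥((W.baseChange K).endEigenPrimaryTorsion 2 π r)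
          (inf_le_inf_right (decomp w) (le_top : κ'.kerSubgroup ≤ ⊤))).ker) *
        Nat.card (resOfLe ↥((W.baseChange K).endEigenPrimaryTorsion 2 π r)
          (inf_le_inf_right (decomp vbar) (le_top : κ'.kerSubgroup ≤ ⊤))).ker := by
  have h := two_mul_relIndex_control_of_frame_dvd hd0 hsq W C hC hK hv hvbar hne π hrel hr κ' hκ' hγ' T hT
  rw [(natCard_ker_control_of_frame_eq_one hd0 W C hC hK vbar hvbar π hrel hr κ' hκ' h7 hsplit).1, mul_one] at h
  exact h

/-- **(R-SURJ) AS DISPLAYED FAILS ON EVERY S3c FRAME WITH (H7): `[𝔖^Γ : res 𝔖_{v̄}(K, W*)] < (∏_{w∈T} #LK_w) · #LK_{v̄}`.** The product is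
positive (finite non-empty local kernels), and twice the index divides it. The displayed hypothesis `hSurj` of LEAD g12's cut 4
(`restrictedControl_two_of_residuals_split_places`, p666063) asserts EQUALITY here; the honest form of the LEAD's «δ = 1» (local-class map
of the lifts ONTO `⊕ LK_w`, memo `S3C-DEFECT-VANISHES-g12.md`) is **(R-SURJ′) `2 · [𝔖^Γ : res 𝔖] = (∏_{w∈T} #LK_w) · #LK_{v̄}`**, i.e.
`[A : 𝔖_{v̄}(K, W*)] = ∏` (`two_mul_relIndex_control_of_frame_eq`), and `e_C` shifts by the constant `−1`.
[cite: Agboola2007, §3 Prop. 3.2, §6] [cite: GreenbergLNM1716, §3 Lemmas 3.1–3.3] -/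
theorem relIndex_control_of_frame_lt_prod_of_not_decomp_le {d : ℤ} (hd0 : d ≠ 0) (hsq : Squarefree d)
    (W : WeierstrassCurve ℚ) [W.IsElliptic] (C : VariableChange ℚ) (hC : C • W = cm7.quadraticTwist (d : ℚ))
    (hK : IsImaginaryQuadratic K) {v vbar : HeightOneSpectrum (𝓞 K)} (hv : ((2 : ℕ) : 𝓞 K) ∈ v.asIdeal)
    (hvbar : ((2 : ℕ) : 𝓞 K) ∈ vbar.asIdeal) (hne : vbar ≠ v) (π : (W.baseChange K).endRing)
    (hrel : (π : AddMonoid.End (W.baseChange K).geomPoints) * π = π - 2) {r : ℤ_[2]} (hr : r * r = r - 2)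
    (κ' : ZpExtension K 2) (hκ' : κ'.IsUnramifiedOutside vbar) {γ' : absoluteGaloisGroup K} (hγ' : κ'.IsTopGenerator γ')
    (T : Finset (HeightOneSpectrum (𝓞 K)))
    (hT : ∀ w : HeightOneSpectrum (𝓞 K), w ∈ T ↔ ((2 : ℕ) : 𝓞 K) ∉ w.asIdeal ∧ ((7 * d : ℤ) : 𝓞 K) ∈ w.asIdeal)
    {w₇ : HeightOneSpectrum (𝓞 K)} (h7 : ((7 : ℕ) : 𝓞 K) ∈ w₇.asIdeal) (hsplit : ¬ decomp w₇ ≤ κ'.layerSubgroup 1) :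
    (((restrictedSelmerBase ↥((W.baseChange K).endEigenPrimaryTorsion 2 π r) 2 vbar).map
        (resOfLe ↥((W.baseChange K).endEigenPrimaryTorsion 2 π r) (le_top : κ'.kerSubgroup ≤ ⊤))).addSubgroupOf
        (restrictedSelmerZp κ' ↥((W.baseChange K).endEigenPrimaryTorsion 2 π r) vbar)).relIndex
      (endInvariants (conjRestricted κ' ↥((W.baseChange K).endEigenPrimaryTorsion 2 π r) vbar γ' - 1)) <
      (∏ w ∈ T, Nat.card (resOfLe ↥((W.baseChange K).endEigenPrimaryTorsion 2 π r)
          (inf_le_inf_right (decomp w) (le_top : κ'.kerSubgroup ≤ ⊤))).ker) *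
        Nat.card (resOfLe ↥((W.baseChange K).endEigenPrimaryTorsion 2 π r)
          (inf_le_inf_right (decomp vbar) (le_top : κ'.kerSubgroup ≤ ⊤))).ker := by
  have hdvd := two_mul_relIndex_control_of_frame_dvd_of_not_decomp_le hd0 hsq W C hC hK hv hvbar hne π hrel hr κ' hκ' hγ'
    T hT h7 hsplit
  -- the product is positive
  have hT0 : ∀ w ∈ T, Nat.card (resOfLe ↥((W.baseChange K).endEigenPrimaryTorsion 2 π r)
      (inf_le_inf_right (decomp w) (le_top : κ'.kerSubgroup ≤ ⊤))).ker ≠ 0 := by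
    intro w hw
    obtain ⟨h2w, h7d⟩ := (hT w).mp hw
    haveI := (finite_and_natCard_localKer_top_of_frame_le_two hd0 hsq W C hC hK vbar hvbar π hrel hr κ' hκ' h2w h7d).1
    exact Nat.card_pos.ne'
  have hvbar0 : Nat.card (resOfLe ↥((W.baseChange K).endEigenPrimaryTorsion 2 π r)
      (inf_le_inf_right (decomp vbar) (le_top : κ'.kerSubgroup ≤ ⊤))).ker ≠ 0 := by
    haveI := (finite_and_natCard_localKer_top_vbar_of_frame_le_four hd0 W C hC hK hv hvbar hne π hrel hr κ').1
    exact Nat.card_pos.ne'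
  have hpos : 0 < (∏ w ∈ T, Nat.card (resOfLe ↥((W.baseChange K).endEigenPrimaryTorsion 2 π r)
      (inf_le_inf_right (decomp w) (le_top : κ'.kerSubgroup ≤ ⊤))).ker) *
        Nat.card (resOfLe ↥((W.baseChange K).endEigenPrimaryTorsion 2 π r)
          (inf_le_inf_right (decomp vbar) (le_top : κ'.kerSubgroup ≤ ⊤))).ker :=
    Nat.pos_of_ne_zero (mul_ne_zero (Finset.prod_ne_zero_iff.mpr hT0) hvbar0)
  have hle := Nat.le_of_dvd hpos hdvd
  omega

/-- **CONVERSELY (no (H7)): if (R-SURJ)'s equality held at a frame, the control kernel there would have order `2`** — i.e. (R-SURJ) and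
(R-KER) «`#ker(control) = 1`» are INCONSISTENT at every frame: `2 · ∏ ∣ ∏ · #ker(control)` with `#ker(control) ≤ 2` (p656507) forces
`#ker(control) = 2`. [cite: Agboola2007, §3 Prop. 3.2] [cite: GreenbergLNM1716, §3 Lemmas 3.1–3.3] -/
theorem natCard_ker_control_of_frame_eq_two_of_relIndex_eq_prod {d : ℤ} (hd0 : d ≠ 0) (hsq : Squarefree d)
    (W : WeierstrassCurve ℚ) [W.IsElliptic] (C : VariableChange ℚ) (hC : C • W = cm7.quadraticTwist (d : ℚ))
    (hK : IsImaginaryQuadratic K) {v vbar : HeightOneSpectrum (𝓞 K)} (hv : ((2 : ℕ) : 𝓞 K) ∈ v.asIdeal)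
    (hvbar : ((2 : ℕ) : 𝓞 K) ∈ vbar.asIdeal) (hne : vbar ≠ v) (π : (W.baseChange K).endRing)
    (hrel : (π : AddMonoid.End (W.baseChange K).geomPoints) * π = π - 2) {r : ℤ_[2]} (hr : r * r = r - 2)
    (κ' : ZpExtension K 2) (hκ' : κ'.IsUnramifiedOutside vbar) {γ' : absoluteGaloisGroup K} (hγ' : κ'.IsTopGenerator γ')
    (T : Finset (HeightOneSpectrum (𝓞 K)))
    (hT : ∀ w : HeightOneSpectrum (𝓞 K), w ∈ T ↔ ((2 : ℕ) : 𝓞 K) ∉ w.asIdeal ∧ ((7 * d : ℤ) : 𝓞 K) ∈ w.asIdeal)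
    (hSurj : (((restrictedSelmerBase ↥((W.baseChange K).endEigenPrimaryTorsion 2 π r) 2 vbar).map
        (resOfLe ↥((W.baseChange K).endEigenPrimaryTorsion 2 π r) (le_top : κ'.kerSubgroup ≤ ⊤))).addSubgroupOf
        (restrictedSelmerZp κ' ↥((W.baseChange K).endEigenPrimaryTorsion 2 π r) vbar)).relIndex
      (endInvariants (conjRestricted κ' ↥((W.baseChange K).endEigenPrimaryTorsion 2 π r) vbar γ' - 1)) =
      (∏ w ∈ T, Nat.card (resOfLe ↥((W.baseChange K).endEigenPrimaryTorsion 2 π r)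
          (inf_le_inf_right (decomp w) (le_top : κ'.kerSubgroup ≤ ⊤))).ker) *
        Nat.card (resOfLe ↥((W.baseChange K).endEigenPrimaryTorsion 2 π r)
          (inf_le_inf_right (decomp vbar) (le_top : κ'.kerSubgroup ≤ ⊤))).ker) :
    Nat.card ↥(restrictedSelmerBase ↥((W.baseChange K).endEigenPrimaryTorsion 2 π r) 2 vbar ⊓
        (resOfLe ↥((W.baseChange K).endEigenPrimaryTorsion 2 π r) (le_top : κ'.kerSubgroup ≤ ⊤)).ker) = 2 := by
  have hj : W.j = -3375 := j_eq_of_smul_eq_cm7Twist hd0 W C hC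
  obtain ⟨θ, hθ⟩ := exists_sq_eq_neg_seven_of_cmEndo_mem_endRing W K hj π hrel
  have hdvd := two_mul_relIndex_control_of_frame_dvd hd0 hsq W C hC hK hv hvbar hne π hrel hr κ' hκ' hγ' T hT
  rw [hSurj] at hdvd
  obtain ⟨hle2, -⟩ := natCard_ker_control_of_frame_le_two hd0 W C hC hK hθ vbar hvbar π hrel hr κ' hκ' hγ'
  have hT0 : ∀ w ∈ T, Nat.card (resOfLe ↥((W.baseChange K).endEigenPrimaryTorsion 2 π r)
      (inf_le_inf_right (decomp w) (le_top : κ'.kerSubgroup ≤ ⊤))).ker ≠ 0 := by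
    intro w hw
    obtain ⟨h2w, h7d⟩ := (hT w).mp hw
    haveI := (finite_and_natCard_localKer_top_of_frame_le_two hd0 hsq W C hC hK vbar hvbar π hrel hr κ' hκ' h2w h7d).1
    exact Nat.card_pos.ne'
  have hvbar0 : Nat.card (resOfLe ↥((W.baseChange K).endEigenPrimaryTorsion 2 π r)
      (inf_le_inf_right (decomp vbar) (le_top : κ'.kerSubgroup ≤ ⊤))).ker ≠ 0 := by
    haveI := (finite_and_natCard_localKer_top_vbar_of_frame_le_four hd0 W C hC hK hv hvbar hne π hrel hr κ').1
    exact Nat.card_pos.ne'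
  have hP0 : (∏ w ∈ T, Nat.card (resOfLe ↥((W.baseChange K).endEigenPrimaryTorsion 2 π r)
      (inf_le_inf_right (decomp w) (le_top : κ'.kerSubgroup ≤ ⊤))).ker) *
        Nat.card (resOfLe ↥((W.baseChange K).endEigenPrimaryTorsion 2 π r)
          (inf_le_inf_right (decomp vbar) (le_top : κ'.kerSubgroup ≤ ⊤))).ker ≠ 0 :=
    mul_ne_zero (Finset.prod_ne_zero_iff.mpr hT0) hvbar0
  -- `2 · P ∣ P · k` with `P ≠ 0` gives `2 ∣ k`; with `k ≤ 2` and `k ≠ 0`, `k = 2`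
  set P := (∏ w ∈ T, Nat.card (resOfLe ↥((W.baseChange K).endEigenPrimaryTorsion 2 π r)
      (inf_le_inf_right (decomp w) (le_top : κ'.kerSubgroup ≤ ⊤))).ker) *
        Nat.card (resOfLe ↥((W.baseChange K).endEigenPrimaryTorsion 2 π r)
          (inf_le_inf_right (decomp vbar) (le_top : κ'.kerSubgroup ≤ ⊤))).ker with hPdef
  set k := Nat.card ↥(restrictedSelmerBase ↥((W.baseChange K).endEigenPrimaryTorsion 2 π r) 2 vbar ⊓
        (resOfLe ↥((W.baseChange K).endEigenPrimaryTorsion 2 π r) (le_top : κ'.kerSubgroup ≤ ⊤)).ker) with hkdef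
  have hk0 : k ≠ 0 := by
    haveI := (finite_ker_control_of_frame hd0 W C hC hK vbar hvbar π r κ' hκ' hγ').1
    exact Nat.card_pos.ne'
  have h2k : 2 ∣ k := by
    exact (Nat.mul_dvd_mul_iff_left (Nat.pos_of_ne_zero hP0)).mp hdvd
  omega

/-- **THE DISPLAYED HYPOTHESIS (R-SURJ) OF CUT 4 IS INCONSISTENT WITH ANY S3c FRAME SATISFYING (H7).** Verbatim `hSurj` of LEAD g12's
`restrictedControl_two_of_residuals_split_places` (p666063) applied to a frame (member of analytic rank one on a globally minimal
model, `K` imaginary quadratic, `v ≠ v̄` over `2`, `π, r` with the pinning clause at `v`, `κ'` unramified outside `v̄` with generator `γ'`)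
at which the place above `7` does not split completely in the first layer of `κ'` yields `False`
(`relIndex_control_of_frame_lt_prod_of_not_decomp_le`). (H7) holds for the CFT line `K*_∞` of `ℚ(√−7)` (memo B15 §1 (C2), -w2 g9;
-w6 g2's first-layer files), so (R-SURJ) as typed is undischargeable; replace it by (R-SURJ′) `2 · relIndex = ∏`.
[cite: Agboola2007, §3 Prop. 3.2, §6] [cite: GreenbergLNM1716, §3 Lemmas 3.1–3.3] -/
theorem false_of_rSurj_of_frame_of_not_decomp_le
    (hSurj : ∀ (d : ℤ), d ≠ 0 → Squarefree d → d % 4 ≠ 1 →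
      ∀ (W : WeierstrassCurve ℚ) [W.IsElliptic] [W.IsGloballyMinimal] (C : VariableChange ℚ),
        C • W = cm7.quadraticTwist (d : ℚ) → W.analyticRank = 1 →
      ∀ (K : Type) [Field K] [NumberField K], IsImaginaryQuadratic K →
      ∀ (v vbar : HeightOneSpectrum (𝓞 K)),
        ((2 : ℕ) : 𝓞 K) ∈ v.asIdeal → ((2 : ℕ) : 𝓞 K) ∈ vbar.asIdeal → vbar ≠ v →
      ∀ (π : (W.baseChange K).endRing), (π : AddMonoid.End (W.baseChange K).geomPoints) * π = π - 2 →
      ∀ (r : ℤ_[2]), r * r = r - 2 →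
        (∀ τ ∈ GreenbergSelmer.inertia v, ∀ x : ↥((W.baseChange K).endEigenPrimaryTorsion 2 π r), τ • x = x ∨ τ • x = -x) →
      ∀ (κ' : ZpExtension K 2), κ'.IsUnramifiedOutside vbar → ∀ (γ' : absoluteGaloisGroup K), κ'.IsTopGenerator γ' →
      ∀ (T : Finset (HeightOneSpectrum (𝓞 K))),
        (∀ w : HeightOneSpectrum (𝓞 K), w ∈ T ↔ ((2 : ℕ) : 𝓞 K) ∉ w.asIdeal ∧ ((7 * d : ℤ) : 𝓞 K) ∈ w.asIdeal) →
        (((restrictedSelmerBase ↥((W.baseChange K).endEigenPrimaryTorsion 2 π r) 2 vbar).map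
            (resOfLe ↥((W.baseChange K).endEigenPrimaryTorsion 2 π r) (le_top : κ'.kerSubgroup ≤ ⊤))).addSubgroupOf
            (restrictedSelmerZp κ' ↥((W.baseChange K).endEigenPrimaryTorsion 2 π r) vbar)).relIndex
          (endInvariants (conjRestricted κ' ↥((W.baseChange K).endEigenPrimaryTorsion 2 π r) vbar γ' - 1)) =
        (∏ w ∈ T, Nat.card (resOfLe ↥((W.baseChange K).endEigenPrimaryTorsion 2 π r) (inf_le_inf_right (decomp w) (le_top : κ'.kerSubgroup ≤ ⊤))).ker) *
          Nat.card (resOfLe ↥((W.baseChange K).endEigenPrimaryTorsion 2 π r) (inf_le_inf_right (decomp vbar) (le_top : κ'.kerSubgroup ≤ ⊤))).ker)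
    {d : ℤ} (hd0 : d ≠ 0) (hsq : Squarefree d) (hd4 : d % 4 ≠ 1)
    (W : WeierstrassCurve ℚ) [W.IsElliptic] [W.IsGloballyMinimal] (C : VariableChange ℚ) (hC : C • W = cm7.quadraticTwist (d : ℚ))
    (hrk : W.analyticRank = 1) (hK : IsImaginaryQuadratic K) {v vbar : HeightOneSpectrum (𝓞 K)}
    (hv : ((2 : ℕ) : 𝓞 K) ∈ v.asIdeal) (hvbar : ((2 : ℕ) : 𝓞 K) ∈ vbar.asIdeal) (hne : vbar ≠ v)
    (π : (W.baseChange K).endRing) (hrel : (π : AddMonoid.End (W.baseChange K).geomPoints) * π = π - 2)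
    {r : ℤ_[2]} (hr : r * r = r - 2)
    (hpin : ∀ τ ∈ GreenbergSelmer.inertia v, ∀ x : ↥((W.baseChange K).endEigenPrimaryTorsion 2 π r), τ • x = x ∨ τ • x = -x)
    (κ' : ZpExtension K 2) (hκ' : κ'.IsUnramifiedOutside vbar) {γ' : absoluteGaloisGroup K} (hγ' : κ'.IsTopGenerator γ')
    {w₇ : HeightOneSpectrum (𝓞 K)} (h7 : ((7 : ℕ) : 𝓞 K) ∈ w₇.asIdeal) (hsplit : ¬ decomp w₇ ≤ κ'.layerSubgroup 1) :
    False := by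
  obtain ⟨T, hT⟩ := exists_finset_seven_mul (K := K) hd0
  have heq := hSurj d hd0 hsq hd4 W C hC hrk K hK v vbar hv hvbar hne π hrel r hr hpin κ' hκ' γ' hγ' T hT
  have hlt := relIndex_control_of_frame_lt_prod_of_not_decomp_le hd0 hsq W C hC hK hv hvbar hne π hrel hr κ' hκ' hγ' T hT h7 hsplit
  exact absurd heq (ne_of_lt hlt)

end Frame
end Summit.BirchSwinnertonDyer.BirchSwinnertonDyer.Theorems.PrintCf2.RestrictedSelmerPair

end
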